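import Mathlib.LinearAlgebra.Matrix.Dual
import Mathlib.LinearAlgebra.Dual.Lemmas
import Summits.MatrixMultiplication.OmegaCensus.SmallFormats.RankOnePlaneCapEquality
import HarnessLib

/-!
# ω-census family (a): the NEAR-saturated rank-one plane law (`|R| = 2r − 6n − 1`) and the pinned Y-form

Cell `pub-omega` (unit `pub-omega-tensor`, gen 22), topic `Summits/MatrixMultiplication/OmegaCensus`
(sub-folder `SmallFormats`). Framing (verbatim): lottery ticket; floor = certified bounds/negative
ranges. HONEST FRAMING: our elementary structural lemmas, the `slack = 1` case next to the equality case
`RankOnePlaneCapEquality` (lit gen 6); CONSTRAINTS used by the cell's structured exclusion engines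
(tensor-g20 engine E1 `SOUNDNESS.md` §6.1, tensor-g21 engine E2 `SOUNDNESS-E2.md` §4: the "near-saturated
row" with its "pinned term" for the classes B and C of the `𝔽₃ ⟨2,2,7⟩ @ 23` residue), here proved for
every field and every `⟨c,2,n⟩`; not a bound on any rank, not progress on `ω`.

Setting: `β` a bilinear computation of `⟨c,m,n⟩` of length `r` (`XY = ∑ f_i(X) g_i(Y) W_i`),
`θ ∈ k^c`, `R` a set of indices, `E ⊇ {θᵀW_i : i ∉ R}`, `φ ⊥ E`.

* `theta_row_pairing` (any `c, m, n`, any `R`): `θᵀ·XY·φ = ∑_{i∈R} f_i(X) g_i(Y) (θᵀW_iφ)` — the `θ`-row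
  of the Brent identity paired with `φ`; the terms outside `R` drop out.
* `x_pairing_of_rowForms`: if the X-forms of `R` are the rank-one forms `f_i(X) = θᵀXη_i` of a common
  row `θ ≠ 0`, then for ALL `x ∈ k^m`: `xᵀYφ = ∑_{i∈R} c_i (x·η_i) g_i(Y)`, `c_i := θᵀW_iφ` (the local
  `⟨1,m,n⟩`-type identity `∑_{i∈R} c_i η_i ⊗ G_i = I ⊗ φ` of E2 §2/§4).
* `pinned_form` (pattern `{s; d, d, …}`): if `x₀ ⊥ η_i` for every `i ∈ R ∖ {t₁}` and `x₀·η_{t₁} = 1`, then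
  `c_{t₁} g_{t₁}(Y) = x₀ᵀYφ` for all `Y`; and `c_{t₁} ≠ 0` as soon as `φ ≠ 0` (`pinned_coeff_ne_zero`), so
  `g_{t₁} = c_{t₁}⁻¹ · (Y ↦ x₀ᵀYφ)` is the rank-one Y-form `a ⊗ φ` — E2's PINNED TERM / forced point.
* `erase_pairing`: for `x₁ ⊥ η_{t₁}` the form `Y ↦ x₁ᵀYφ` is the combination `∑_{i∈R∖t₁} c_i (x₁·η_i) g_i`
  (E2's "double class carries at most one point" source identity).
* `card_vanishing_quant_near` (`m = 2`, `c ≥ 2`, X-forms of `R` vanishing on the plane `{λzᵀ}`,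
  `|R| + 6n + 1 = 2r`, i.e. ONE BELOW the cap `2r − 6n` of `card_vanishing_le_two_mul_sub`): there is
  `θ ≠ 0`, `θ ⊥ λ`, with `E := span{θᵀW_i : i ∉ R}` of dimension EXACTLY `|Rᶜ| − 2n` (`= 4n − r + 1`;
  `2·dim E + |R| = 2n + 1`), every common zero of the Y-forms of `R` has both rows in `E`, and those
  Y-forms have rank `≥ |R| − 1`.  At `r = 3n + 2`, `|R| = 3` (`finrank_add_one_of_three_n_add_two`):
  `dim E = n − 1`, so `F := E^⊥` is a LINE `⟨φ₀⟩` (`exists_perp_line_of_finrank_add_one`: a nonzero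
  `φ₀ ⊥ E` exists and every `ψ ⊥ E` is a multiple of it) — the engines' `φ₀`, canonical up to a scalar.
  Column planes `{z λᵀ}`: apply the row statements to the transpose dual (`exists_transposeDual`), as
  `RankOnePlaneCapEqualityCol` does for the equality case; not spelled out here.

*Proofs.* The pairing identities are the `θ`-row of `β.map_eq_sum` dotted with `φ`, plus the surjectivity
of `X ↦ θᵀX`. The dimension law repeats lit gen 5/6's chain `dim E + 2n ≤ |Rᶜ|`
(`finrank_span_rows_add_le`) and `2n = rank G + dim ker G ≤ |R| + 2·dim E` (common zeros have rows in
`E`, `commonZero_row_mem`) and closes it by parity (`|R|` is odd). What is NOT here: the enumeration of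
`φ₀` up to the symmetry group, the block structure of saturated rows, anything specific to `𝔽₃`.
-/

namespace Summit.MatrixMultiplication.OmegaCensus.RankOnePlaneCapGeneral

open Module Matrix Literature.Computability.AlgebraicComplexity

variable {k : Type*} [Field k] {c m n : ℕ} {ι : Type*} [Fintype ι]

/-! ## The `θ`-row of the Brent identity paired with `φ ⊥ E` -/

/-- **Row pairing identity.** If `θᵀW_i ⊥ φ` for every `i ∉ R`, then for all `X, Y`:
`θᵀ (XY) φ = ∑_{i ∈ R} f_i(X) g_i(Y) · (θᵀ W_i φ)`. -/
theorem theta_row_pairing (β : BilinComp (mulBilin k c m n) ι) (θ : Fin c → k) (R : Finset ι)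
    (φ : Fin n → k) (hφ : ∀ i, i ∉ R → (θ ᵥ* β.w i) ⬝ᵥ φ = 0)
    (X : Matrix (Fin c) (Fin m) k) (Y : Matrix (Fin m) (Fin n) k) :
    (θ ᵥ* (X * Y)) ⬝ᵥ φ = ∑ i ∈ R, β.f i X * β.g i Y * ((θ ᵥ* β.w i) ⬝ᵥ φ) := by
  classical
  have h := β.map_eq_sum X Y
  rw [mulBilin_apply] at h
  rw [h, vecMul_sum_smul, sum_dotProduct]
  simp_rw [smul_dotProduct, smul_eq_mul]
  rw [← Finset.sum_sdiff (Finset.subset_univ R), Finset.sum_eq_zero (fun i hi => ?_), zero_add]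
  rw [hφ i (Finset.mem_sdiff.1 hi).2, mul_zero]

/-- `X ↦ θᵀX` is onto `k^m` when `θ` has a nonzero coordinate: `θᵀ (e_{κ'} (θ_{κ'})⁻¹ xᵀ) = x`. -/
theorem vecMul_vecMulVec_single_inv {θ : Fin c → k} {κ' : Fin c} (hκ' : θ κ' ≠ 0) (x : Fin m → k) :
    θ ᵥ* vecMulVec (Pi.single κ' (θ κ')⁻¹) x = x := by
  rw [vecMul_vecMulVec, dotProduct_single, mul_inv_cancel₀ hκ', one_smul]

/-- **Local `⟨1,m,n⟩` identity.** If the X-forms of `R` are rank-one forms `f_i(X) = (θᵀX)·η_i` with a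
common row `θ` (`θ_{κ'} ≠ 0`) and `θᵀW_i ⊥ φ` for `i ∉ R`, then for every `x ∈ k^m` and every `Y`:
`xᵀ Y φ = ∑_{i∈R} (θᵀW_iφ) · (x·η_i) · g_i(Y)`. -/
theorem x_pairing_of_rowForms (β : BilinComp (mulBilin k c m n) ι) {θ : Fin c → k} {κ' : Fin c}
    (hκ' : θ κ' ≠ 0) (R : Finset ι) (η : ι → Fin m → k)
    (hf : ∀ i ∈ R, ∀ X : Matrix (Fin c) (Fin m) k, β.f i X = (θ ᵥ* X) ⬝ᵥ η i)
    (φ : Fin n → k) (hφ : ∀ i, i ∉ R → (θ ᵥ* β.w i) ⬝ᵥ φ = 0)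
    (x : Fin m → k) (Y : Matrix (Fin m) (Fin n) k) :
    x ⬝ᵥ (Y *ᵥ φ) = ∑ i ∈ R, ((θ ᵥ* β.w i) ⬝ᵥ φ) * (x ⬝ᵥ η i) * β.g i Y := by
  classical
  set X : Matrix (Fin c) (Fin m) k := vecMulVec (Pi.single κ' (θ κ')⁻¹) x with hX
  have hθX : θ ᵥ* X = x := vecMul_vecMulVec_single_inv hκ' x
  have h := theta_row_pairing β θ R φ hφ X Y
  rw [← vecMul_vecMul, hθX, ← dotProduct_mulVec] at h
  rw [h]
  refine Finset.sum_congr rfl fun i hi => ?_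
  rw [hf i hi X, hθX]
  ring

/-- **Pinned Y-form** (pattern `{s; d, d, …}`): if `x₀ ⊥ η_i` for all `i ∈ R`, `i ≠ t₁`, and
`x₀ · η_{t₁} = 1`, then `(θᵀW_{t₁}φ) · g_{t₁}(Y) = x₀ᵀ Y φ` for every `Y`: the Y-form of `t₁` is, up to the
scalar `c_{t₁} = θᵀW_{t₁}φ`, the rank-one form `Y ↦ x₀ᵀYφ` ("`a ⊗ φ₀`"). -/
theorem pinned_form (β : BilinComp (mulBilin k c m n) ι) {θ : Fin c → k} {κ' : Fin c}
    (hκ' : θ κ' ≠ 0) (R : Finset ι) (η : ι → Fin m → k)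
    (hf : ∀ i ∈ R, ∀ X : Matrix (Fin c) (Fin m) k, β.f i X = (θ ᵥ* X) ⬝ᵥ η i)
    (φ : Fin n → k) (hφ : ∀ i, i ∉ R → (θ ᵥ* β.w i) ⬝ᵥ φ = 0)
    {t₁ : ι} (ht₁ : t₁ ∈ R) (x₀ : Fin m → k) (hx₀ : ∀ i ∈ R, i ≠ t₁ → x₀ ⬝ᵥ η i = 0)
    (h1 : x₀ ⬝ᵥ η t₁ = 1) (Y : Matrix (Fin m) (Fin n) k) :
    ((θ ᵥ* β.w t₁) ⬝ᵥ φ) * β.g t₁ Y = x₀ ⬝ᵥ (Y *ᵥ φ) := by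
  classical
  rw [x_pairing_of_rowForms β hκ' R η hf φ hφ x₀ Y, Finset.sum_eq_single_of_mem t₁ ht₁ (fun i hi hne => by
    rw [hx₀ i hi hne, mul_zero, zero_mul]), h1, mul_one]

/-- The pinned coefficient is nonzero: with the hypotheses of `pinned_form` and `φ ≠ 0`,
`θᵀ W_{t₁} φ ≠ 0` (so `g_{t₁} = (θᵀW_{t₁}φ)⁻¹ · (Y ↦ x₀ᵀYφ)` is FORCED by `x₀` and `φ`). -/
theorem pinned_coeff_ne_zero (β : BilinComp (mulBilin k c m n) ι) {θ : Fin c → k} {κ' : Fin c}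
    (hκ' : θ κ' ≠ 0) (R : Finset ι) (η : ι → Fin m → k)
    (hf : ∀ i ∈ R, ∀ X : Matrix (Fin c) (Fin m) k, β.f i X = (θ ᵥ* X) ⬝ᵥ η i)
    {φ : Fin n → k} (hφ0 : φ ≠ 0) (hφ : ∀ i, i ∉ R → (θ ᵥ* β.w i) ⬝ᵥ φ = 0)
    {t₁ : ι} (ht₁ : t₁ ∈ R) (x₀ : Fin m → k) (hx₀ : ∀ i ∈ R, i ≠ t₁ → x₀ ⬝ᵥ η i = 0)
    (h1 : x₀ ⬝ᵥ η t₁ = 1) : (θ ᵥ* β.w t₁) ⬝ᵥ φ ≠ 0 := by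
  classical
  -- a coordinate `b` with `x₀ b ≠ 0` (else `x₀ ⬝ η_{t₁} = 0 ≠ 1`) and `l` with `φ l ≠ 0`
  obtain ⟨b, hb⟩ : ∃ b, x₀ b ≠ 0 := by
    by_contra h0
    simp only [not_exists, not_not] at h0
    have : x₀ = 0 := funext h0
    rw [this, zero_dotProduct] at h1
    exact zero_ne_one h1
  obtain ⟨l, hl⟩ : ∃ l, φ l ≠ 0 := by
    by_contra h0
    simp only [not_exists, not_not] at h0
    exact hφ0 (funext h0)
  intro hc
  have h := pinned_form β hκ' R η hf φ hφ ht₁ x₀ hx₀ h1 (vecMulVec (Pi.single b 1) (Pi.single l 1))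
  rw [hc, zero_mul, dotProduct_mulVec, vecMul_vecMulVec, dotProduct_single, mul_one, smul_dotProduct,
    single_dotProduct, one_mul, smul_eq_mul] at h
  exact mul_ne_zero hb hl h.symm

/-- **The other terms of the near row** (E2's "double class" identity): for `x₁ ⊥ η_{t₁}` the form
`Y ↦ x₁ᵀYφ` equals `∑_{i ∈ R ∖ t₁} (θᵀW_iφ) (x₁·η_i) g_i(Y)`. For the pattern `{s; d, d}` with
`x₁·η_d = 1` this reads `c₂ g₂ + c₃ g₃ = (Y ↦ x₁ᵀYφ)`. -/
theorem erase_pairing [DecidableEq ι] (β : BilinComp (mulBilin k c m n) ι) {θ : Fin c → k} {κ' : Fin c}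
    (hκ' : θ κ' ≠ 0) (R : Finset ι) (η : ι → Fin m → k)
    (hf : ∀ i ∈ R, ∀ X : Matrix (Fin c) (Fin m) k, β.f i X = (θ ᵥ* X) ⬝ᵥ η i)
    (φ : Fin n → k) (hφ : ∀ i, i ∉ R → (θ ᵥ* β.w i) ⬝ᵥ φ = 0)
    {t₁ : ι} (ht₁ : t₁ ∈ R) (x₁ : Fin m → k) (hx₁ : x₁ ⬝ᵥ η t₁ = 0)
    (Y : Matrix (Fin m) (Fin n) k) :
    x₁ ⬝ᵥ (Y *ᵥ φ) = ∑ i ∈ R.erase t₁, ((θ ᵥ* β.w i) ⬝ᵥ φ) * (x₁ ⬝ᵥ η i) * β.g i Y := by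
  classical
  rw [x_pairing_of_rowForms β hκ' R η hf φ hφ x₁ Y, ← Finset.add_sum_erase R _ ht₁, hx₁, mul_zero,
    zero_mul, zero_add]

/-! ## The dimension law one below the cap (`m = 2`) -/

/-- **Near-saturated rank-one plane law** (`⟨c,2,n⟩`, `c ≥ 2`). If the X-forms of `R` vanish on
`{λ zᵀ : z ∈ k²}` (`λ ≠ 0`) and `|R| + 6n + 1 = 2r` (one below the cap `2r − 6n`), then with a suitable
`θ ≠ 0`, `θ ⊥ λ`, and `E = span{θᵀW_i : i ∉ R}`:
`dim E + 2n = |Rᶜ|` and `2·dim E + |R| = 2n + 1` (so `dim E = 4n − r + 1`), every common zero of the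
Y-forms of `R` has both rows in `E`, and the Y-forms of `R` have rank `≥ |R| − 1`. -/
theorem card_vanishing_quant_near [DecidableEq ι] (hc : 2 ≤ c)
    (β : BilinComp (mulBilin k c 2 n) ι)
    {lam : Fin c → k} (hlam : lam ≠ 0) (R : Finset ι)
    (hR : ∀ i ∈ R, ∀ z : Fin 2 → k, β.f i (vecMulVec lam z) = 0)
    (hnear : R.card + 6 * n + 1 = 2 * Fintype.card ι) :
    ∃ (θ : Fin c → k) (E : Submodule k (Fin n → k)),
      θ ≠ 0 ∧ θ ⬝ᵥ lam = 0 ∧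
      E = Submodule.span k ((fun i => θ ᵥ* β.w i) '' ↑(Finset.univ \ R)) ∧
      finrank k E + 2 * n = (Finset.univ \ R).card ∧
      2 * finrank k E + R.card = 2 * n + 1 ∧
      (∀ Y : Matrix (Fin 2) (Fin n) k, (∀ i ∈ R, β.g i Y = 0) → ∀ μ, Y μ ∈ E) ∧
      R.card ≤ finrank k (LinearMap.range (LinearMap.pi fun i : {i // i ∈ R} => β.g i.1)) + 1 := by
  classical
  set Rc : Finset ι := Finset.univ \ R with hRc
  have hcardR : Rc.card + R.card = Fintype.card ι := by
    rw [hRc, Finset.card_sdiff_add_card_eq_card (Finset.subset_univ R), Finset.card_univ]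
  have A1 : ∀ (z : Fin 2 → k) (Y : Matrix (Fin 2) (Fin n) k), vecMulVec lam z * Y =
      ∑ i ∈ Rc, (β.f i (vecMulVec lam z) * β.g i Y) • β.w i := by
    intro z Y
    have h := β.map_eq_sum (vecMulVec lam z) Y
    rw [mulBilin_apply] at h
    rw [h, ← Finset.sum_sdiff (Finset.subset_univ R), add_eq_left]
    exact Finset.sum_eq_zero fun i hi => by rw [hR i hi, zero_mul, zero_smul]
  -- `θ ⊥ λ` with a nonzero coordinate (as in `card_vanishing_quant`)
  obtain ⟨κ₁, hκ₁⟩ : ∃ κ, lam κ ≠ 0 := by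
    by_contra h0
    simp only [not_exists, not_not] at h0
    exact hlam (funext h0)
  obtain ⟨κ₂, hκ₂⟩ : ∃ κ : Fin c, κ ≠ κ₁ := by
    by_cases h0 : κ₁ = ⟨0, by omega⟩
    · exact ⟨⟨1, by omega⟩, fun h => by rw [h0] at h; exact absurd (congrArg Fin.val h) (by simp)⟩
    · exact ⟨⟨0, by omega⟩, fun h => h0 h.symm⟩
  set θ : Fin c → k := Pi.single κ₂ (lam κ₁) - Pi.single κ₁ (lam κ₂) with hθ
  have hθdot : θ ⬝ᵥ lam = 0 := by
    rw [hθ, sub_dotProduct, single_dotProduct, single_dotProduct]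
    ring
  have hθlam : ∀ z : Fin 2 → k, θ ᵥ* vecMulVec lam z = 0 := by
    intro z
    ext μ
    have : (θ ᵥ* vecMulVec lam z) μ = (θ ⬝ᵥ lam) * z μ := by
      simp [Matrix.vecMul, dotProduct, vecMulVec_apply, Finset.sum_mul, mul_assoc]
    rw [this, hθdot, zero_mul, Pi.zero_apply]
  have hκ' : θ κ₂ ≠ 0 := by
    rw [hθ, Pi.sub_apply, Pi.single_eq_same, Pi.single_eq_of_ne hκ₂, sub_zero]
    exact hκ₁
  have hθne : θ ≠ 0 := fun h0 => hκ' (by rw [h0]; rfl)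
  -- step (1): `dim E + 2n ≤ |Rᶜ|`
  set E : Submodule k (Fin n → k) := Submodule.span k ((fun i => θ ᵥ* β.w i) '' ↑Rc) with hEdef
  have L1 : finrank k E + 2 * n ≤ Rc.card :=
    finrank_span_rows_add_le β.g hlam (fun i z => β.f i (vecMulVec lam z)) θ hθlam Rc.card Rc β.w
      rfl A1
  have hE : ∀ i, i ∉ R → θ ᵥ* β.w i ∈ E := by
    intro i hiR
    have hiRc : i ∈ Rc := Finset.mem_sdiff.2 ⟨Finset.mem_univ i, hiR⟩
    exact Submodule.subset_span ⟨i, by exact_mod_cast hiRc, rfl⟩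
  -- step (2): common zeros have rows in `E`, so `2n ≤ rank + 2 dim E ≤ |R| + 2 dim E`
  let G : Matrix (Fin 2) (Fin n) k →ₗ[k] ({i // i ∈ R} → k) :=
    LinearMap.pi fun i : {i // i ∈ R} => β.g i.1
  have hGapply : ∀ (Y : Matrix (Fin 2) (Fin n) k) (i : {i // i ∈ R}), G Y i = β.g i.1 Y :=
    fun Y i => rfl
  have hkerR : ∀ Y, Y ∈ LinearMap.ker G ↔ ∀ i ∈ R, β.g i Y = 0 := by
    intro Y
    rw [LinearMap.mem_ker]
    constructor
    · intro hY i hi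
      have := congrFun hY ⟨i, hi⟩
      simpa [hGapply] using this
    · intro hY
      funext i
      simpa [hGapply] using hY i.1 i.2
  have hrow : ∀ Y ∈ LinearMap.ker G, ∀ μ : Fin 2, (Y μ : Fin n → k) ∈ E := fun Y hY μ =>
    commonZero_row_mem β hκ' R E hE Y ((hkerR Y).1 hY) μ
  let ψ : LinearMap.ker G →ₗ[k] (Fin 2 → E) :=
    { toFun := fun Y μ => ⟨(Y : Matrix (Fin 2) (Fin n) k) μ, hrow Y Y.2 μ⟩
      map_add' := fun Y Y' => by ext μ ν; rfl
      map_smul' := fun a Y => by ext μ ν; rfl }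
  have hψ : Function.Injective ψ := by
    intro Y Y' hYY
    apply Subtype.ext
    ext μ ν
    have := congrArg (fun F => ((F μ : E) : Fin n → k) ν) hYY
    simpa [ψ] using this
  have hpi : finrank k (Fin 2 → E) = 2 * finrank k E := by
    rw [Module.finrank_pi_fintype]
    simp [Finset.sum_const]
  have hker : finrank k (LinearMap.ker G) ≤ 2 * finrank k E := by
    have := LinearMap.finrank_le_finrank_of_injective hψ
    rwa [hpi] at this
  have hfun : finrank k ({i // i ∈ R} → k) = R.card := by
    rw [Module.finrank_fintype_fun_eq_card, Fintype.card_coe]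
  have hrange : finrank k (LinearMap.range G) ≤ R.card := by
    have := Submodule.finrank_le (LinearMap.range G)
    rwa [hfun] at this
  have hrn := LinearMap.finrank_range_add_finrank_ker G
  have htop : finrank k (Matrix (Fin 2) (Fin n) k) = 2 * n := by simp [Module.finrank_matrix]
  rw [htop] at hrn
  -- arithmetic: `|R|` is odd, the window for `2 dim E` has length one
  have hE1 : finrank k E + 2 * n = Rc.card := by omega
  have hE2 : 2 * finrank k E + R.card = 2 * n + 1 := by omega
  have hrk : R.card ≤ finrank k (LinearMap.range G) + 1 := by omega
  refine ⟨θ, E, hθne, hθdot, hEdef, hE1, hE2, fun Y hY μ => ?_, hrk⟩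
  exact hrow Y ((hkerR Y).2 hY) μ

/-- **`r = 3n + 2`, three terms in the row plane** (the census regime of `⟨2,2,n⟩ @ 3n+2`, point cap `2`,
row cap `4`): a row plane holding exactly `3` X-forms forces `dim E = n − 1`, i.e. `F := E^⊥` is a line —
the engines' `φ₀` — and every common zero of the three Y-forms has both rows in `E`. -/
theorem finrank_add_one_of_three_n_add_two [DecidableEq ι] (hc : 2 ≤ c)
    (β : BilinComp (mulBilin k c 2 n) ι)
    {lam : Fin c → k} (hlam : lam ≠ 0) (R : Finset ι)
    (hR : ∀ i ∈ R, ∀ z : Fin 2 → k, β.f i (vecMulVec lam z) = 0)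
    (hr : Fintype.card ι = 3 * n + 2) (h3 : R.card = 3) :
    ∃ (θ : Fin c → k) (E : Submodule k (Fin n → k)),
      θ ≠ 0 ∧ θ ⬝ᵥ lam = 0 ∧
      E = Submodule.span k ((fun i => θ ᵥ* β.w i) '' ↑(Finset.univ \ R)) ∧
      finrank k E + 1 = n ∧
      (∀ Y : Matrix (Fin 2) (Fin n) k, (∀ i ∈ R, β.g i Y = 0) → ∀ μ, Y μ ∈ E) := by
  obtain ⟨θ, E, hθ, hθlam, hEdef, hE1, hE2, hzero, -⟩ :=
    card_vanishing_quant_near hc β hlam R hR (by omega)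
  exact ⟨θ, E, hθ, hθlam, hEdef, by omega, hzero⟩

/-! ## `F = E^⊥` is a line at `r = 3n + 2` -/

/-- If `dim E = n − 1` then the orthogonal complement of `E` for the dot product is a LINE: there is
`φ₀ ≠ 0` with `E ⊥ φ₀`, and every `ψ ⊥ E` is a multiple of `φ₀` (the engines' `φ₀`, unique up to a
scalar). -/
theorem exists_perp_line_of_finrank_add_one {E : Submodule k (Fin n → k)}
    (hE : finrank k E + 1 = n) :
    ∃ φ₀ : Fin n → k, φ₀ ≠ 0 ∧ (∀ e ∈ E, e ⬝ᵥ φ₀ = 0) ∧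
      ∀ ψ : Fin n → k, (∀ e ∈ E, e ⬝ᵥ ψ = 0) → ∃ a : k, ψ = a • φ₀ := by
  classical
  set ev : (Fin n → k) ≃ₗ[k] Module.Dual k (Fin n → k) := dotProductEquiv k (Fin n) with hev
  have hev_apply : ∀ v w : Fin n → k, ev v w = v ⬝ᵥ w := fun v w => rfl
  set P : Submodule k (Fin n → k) := E.dualAnnihilator.map (ev.symm : Module.Dual k (Fin n → k) →ₗ[k] (Fin n → k))
    with hP
  have hmemP : ∀ ψ : Fin n → k, ψ ∈ P ↔ ∀ e ∈ E, e ⬝ᵥ ψ = 0 := by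
    intro ψ
    rw [hP, Submodule.mem_map]
    constructor
    · rintro ⟨ℓ, hℓ, rfl⟩ e he
      rw [Submodule.mem_dualAnnihilator] at hℓ
      rw [dotProduct_comm, ← hev_apply, LinearEquiv.coe_coe, LinearEquiv.apply_symm_apply]
      exact hℓ e he
    · intro hψ
      refine ⟨ev ψ, ?_, ?_⟩
      · rw [Submodule.mem_dualAnnihilator]
        intro e he
        rw [hev_apply, dotProduct_comm]
        exact hψ e he
      · rw [LinearEquiv.coe_coe, LinearEquiv.symm_apply_apply]
  have hfinP : finrank k P = 1 := by
    rw [hP, LinearEquiv.finrank_map_eq]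
    have h1 := Subspace.finrank_add_finrank_dualAnnihilator_eq E
    have h2 : finrank k (Fin n → k) = n := by simp
    omega
  obtain ⟨v, hv0, hv⟩ := finrank_eq_one_iff'.1 hfinP
  refine ⟨(v : Fin n → k), fun h0 => hv0 (Subtype.ext h0), (hmemP v).1 v.2, fun ψ hψ => ?_⟩
  obtain ⟨a, ha⟩ := hv ⟨ψ, (hmemP ψ).2 hψ⟩
  exact ⟨a, by simpa using congrArg Subtype.val ha.symm⟩

end Summit.MatrixMultiplication.OmegaCensus.RankOnePlaneCapGeneral
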